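import Summits.ResolutionOfSingularities.ResolutionOfSingularities.Theorems.MarkedTransferCampaignW46MohWindowSurfaceTameExitBound
import HarnessLib

/-!
# [OURS · L1 W4.6 rung (iii-2), EVERY `p`] Surface Moh window — THE HEAVY-CENTRE DICHOTOMY: an infinite permissible sequence inside
# the coefficient surface-window regime blows up NON-TAME (heavy-root) centres INFINITELY OFTEN (cell res-hironaka, LADDER-RESOLUTION
# rung L, D-0089; seat res-L1-s46-pv-5 gen 5; host MarkedTransfer, `--supports stmt-ResolutionOfSingularities-16155 --as helper`;
# statement file `…CampaignW46MohWindowSurface.lean`)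

HONEST FRAMING. Nothing here is a statement of H. Hironaka's manuscript [Hironaka2017] and nothing here asserts that any
statement of it holds. THEOREMS about the OURS regime `CampaignW46.Regime.mohWindowSurface` (o1 §5; every prime `p`, every field
`K` of characteristic `p`) — the NON-TAME all-window rung `MohWindowSurfaceInsepPermissiblyTerminates p K` is OPEN for `p ≥ 3`
(RUNG MAP (iii-2)); this file proves the REDUCTION TO THE HEAVY SIDE that the (H)/(H2) programme of res-D-pv-008 / res-D-pv-050
starts from: along any INFINITE in-regime permissible sequence, infinitely many of the blown-up centres are HEAVY points (their
coefficient presentations are not tame: the residue form has a `κ`-rational root of multiplicity `≥ p` in one of the two charts).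
MECHANISM: res-D-pv-050's tame drop law needs tameness ONLY AT THE CENTRE (`residualOrder_lt_of_over_tame_centre`, the proof of
`MohWindowSurfacePermissible.residualOrder_lt_of_over_centre` re-run with the regime hypotheses weakened to the coefficient regime);
with the child count (`…ChildCount.lean`) the potential `Σ_{Sing} (4p − 1)^{residualOrder}` of `…TameExitBound.lean` drops by `≥ 1`
at every TAME-centred step, so a tail of tame-centred steps is finite. AI-written; AI review is weaker than expert review. No
`sorry`; axioms standard.

WHAT IS PROVED.
* `residualOrder_lt_of_over_tame_centre` — the drop over a TAME centre inside `Regime.mohWindowSurface` (both stages).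
* `potential_succ_add_one_le_of_tame_centre` — the potential drops by `≥ 1` at a tame-centred in-regime step.
* `PermissibleRun.exists_not_tame_centre_ge` — **HEAVY-CENTRE DICHOTOMY**: for an infinite §2.1-permissible sequence inside
  `Regime.mohWindowSurface` and every `k₀` there is `k ≥ k₀` whose centre point is NOT tame.
[ZariskiSamuel1960] [Matsumura1987] [HauserWagner2014] [CossartPiltant2008]
-/

noncomputable section

set_option linter.dupNamespace false -- mandated namespace of this single-conjunct summit

open CategoryTheory AlgebraicGeometry TopologicalSpace IsLocalRing

namespace Summit.ResolutionOfSingularities.ResolutionOfSingularities.Theorems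

namespace CampaignW46

open Literature.AlgebraicGeometry.Resolution
open Literature.AlgebraicGeometry.Hironaka2017.S02Preliminaries
open Literature.AlgebraicGeometry.Hironaka2017.Datum
open Literature.AlgebraicGeometry.Hironaka2017.S16Proof
open Scheme.IdealSheafData
open Polynomial

universe u

section Campaign

variable {p : ℕ} [Fact p.Prime] {K : Type u} [Field K] [CharP K p]
variable {A A' : AmbientDatum p K} {E : IdealExponent A.Z}

/-! ## 1. The drop over a TAME centre inside the coefficient regime -/

/-- **[OURS · L1 W4.6 rung (iii-2)] THE DROP OVER A TAME CENTRE** (res-D-pv-050's `MohWindowSurfacePermissible.residualOrder_lt_of_over_centre`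
with the regime hypotheses weakened: the coefficient regime `Regime.mohWindowSurface` at both stages, tameness `MohWindowSurfaceTameAt`
ONLY at the centre). At every singular point `x′` of the transform over the centre the residual order drops strictly. The proof is
res-D-pv-050's (ring-level step `MohWindowSurface.exponent_lt_of_chart` in the charts `x`, `y`; chart `z` carries no singular point).
NOT a statement of the manuscript. [folklore] -/
theorem residualOrder_lt_of_over_tame_centre {D : Closeds A.Z} (π : A'.Z ⟶ A.Z) (hπ : IsBlowup π (vanishingIdeal D))
    (hD : E.IsPermissibleCentre A.hom D) (hRg : Regime.mohWindowSurface A E)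
    (hRg' : Regime.mohWindowSurface A' (E.transform π D))
    (htame : ∀ ξ ∈ (D : Set A.Z), MohWindowSurfaceTameAt E.b (A.Z.presheaf.stalk ξ) (stalkIdeal E.J ξ))
    {x' : A'.Z} (hx' : x' ∈ (E.transform π D).sing) (hover : π.base x' ∈ (D : Set A.Z)) :
    (residualOrder (E.transform π D).b (A'.Z.presheaf.stalk x') (stalkIdeal (E.transform π D).J x')).toNat <
      (residualOrder E.b (A.Z.presheaf.stalk (π.base x')) (stalkIdeal E.J (π.base x'))).toNat := by
  classical
  obtain ⟨ξ, hξS, hξcl, hDξ⟩ := IsPermissibleCentre.exists_eq_singleton_of_isolatedSing hD ⟨hRg.2.1, hRg.2.2.1⟩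
  have hπx : π.base x' = ξ := by simpa [hDξ] using hover
  obtain ⟨hb, -, -, -⟩ := hRg
  obtain ⟨-, -, -, hwin'⟩ := hRg'
  have hbE' : (E.transform π D).b = E.b := rfl
  haveI : IsLocallyNoetherian A'.Z := by
    haveI := A'.smooth
    exact LocallyOfFiniteType.isLocallyNoetherian A'.hom
  have hp1 : 1 ≤ p := (Fact.out : p.Prime).one_lt.le
  -- the tame presentation downstairs, at `π x' = ξ`
  obtain ⟨hRreg, h3, x, y, z, hxyz, d, a, hbd, hd2, hunit, hJ, htx, hty⟩ := htame _ hover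
  rw [hb] at hbd hd2 hJ htx hty
  haveI := hRreg
  -- the coefficient presentation upstairs, at `x'`
  obtain ⟨hLreg, h3L, x₁, y₁, z₁, hxyz₁, d₁, a₁, hbd₁, hd2₁, hunit₁, hJ₁⟩ := hwin' _ hx'
  rw [hbE', hb] at hbd₁ hd2₁ hJ₁
  haveI := hLreg
  haveI : CharP (A.Z.presheaf.stalk (π.base x')) p := Lem16p11Proof.charP_stalk A (𝟙 A.Z) _
  haveI : CharP (A'.Z.presheaf.stalk x') p := Lem16p11Proof.charP_stalk A π x'
  -- both residual orders are the exponents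
  rw [hbE', hb, hJ, hJ₁, MohWindowSurface.residualOrder_coeff p hLreg h3L hxyz₁ hbd₁ hd2₁ hunit₁,
    MohWindowSurface.residualOrder_coeff p hRreg h3 hxyz hbd hd2 hunit, ENat.toNat_coe, ENat.toNat_coe]
  -- the Rees chart at `x'`
  set c : Fin 3 → A.Z.presheaf.stalk (π.base x') := ![x, y, z] with hc_def
  have hc : Ideal.span (Set.range c) = maximalIdeal _ := by rw [hc_def, MohWindowSurface.range_vec3]; exact hxyz
  have hY : stalkIdeal (vanishingIdeal D) (π.base x') = maximalIdeal (A.Z.presheaf.stalk (π.base x')) := by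
    apply stalkIdeal_vanishingIdeal_eq_maximalIdeal_of_closure_eq
    rw [hDξ, hπx, hξcl.closure_eq]
  have hcY : Ideal.span (Set.range c) = stalkIdeal (vanishingIdeal D) (π.base x') := hc.trans hY.symm
  obtain ⟨j, 𝔴, χ, hχ, hloc, h𝔴⟩ := hπ.exists_reesChart_stalk x' c hcY
  letI := χ.toAlgebra
  haveI : IsLocalization.AtPrime (A'.Z.presheaf.stalk x') 𝔴.asIdeal := hloc
  set ψ : A.Z.presheaf.stalk (π.base x') →+* A'.Z.presheaf.stalk x' := (π.stalkMap x').hom with hψ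
  have hψa : ∀ r, ψ r = (algebraMap (chartRing c j) (A'.Z.presheaf.stalk x') :
      chartRing c j →+* A'.Z.presheaf.stalk x') (chartBase c j r) := fun r => (hχ r).symm
  have hrel : ∀ l, ψ (c l) = ψ (c j) * χ (chartGen c j l) := stalkMap_apply_eq_mul_chartGen j χ hχ
  have hCmap : (stalkIdeal (vanishingIdeal D) (π.base x')).map ψ = Ideal.span {ψ (c j)} := by
    rw [← hcY, Ideal.map_span_range_eq_span_singleton _ c j _ hrel]
  have hstalk : stalkIdeal (E.transform π D).J x' =
      Submodule.colon (Ideal.span {ψ (z ^ p + ∑ k ∈ Finset.range (d + 1), a k * x ^ (d - k) * y ^ k)})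
        ((Ideal.span {ψ (c j)} ^ p : Ideal _) : Set _) := by
    show stalkIdeal (controlledTransform π (vanishingIdeal D) E.J E.b) x' = _
    rw [controlledTransform, stalkIdeal_colon, stalkIdeal_pow, stalkIdeal_comap_eq_map_stalkMap,
      stalkIdeal_comap_eq_map_stalkMap, ← hψ, hCmap, hJ, Ideal.map_span, Set.image_singleton, hb]
  have hx'sing : stalkIdeal (E.transform π D).J x' ≤ maximalIdeal _ ^ p := by
    have := (le_idealOrder_iff (E.transform π D).J x' (E.transform π D).b).mp hx'
    rwa [hbE', hb] at this
  haveI : IsDomain (A'.Z.presheaf.stalk x') := isDomain_of_isRegularLocalRing _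
  -- which chart?
  obtain rfl | rfl | rfl : j = 0 ∨ j = 1 ∨ j = 2 := by
    rcases j with ⟨j, hj⟩
    have : j = 0 ∨ j = 1 ∨ j = 2 := by omega
    rcases this with rfl | rfl | rfl
    · exact Or.inl rfl
    · exact Or.inr (Or.inl rfl)
    · exact Or.inr (Or.inr rfl)
  · have htx' : ∀ τ : ResidueField (A.Z.presheaf.stalk (π.base x')), ¬ (X - C τ) ^ p ∣
        ∑ k ∈ Finset.range (d + 1), C (residue _ (a k)) * X ^ (min k d) := by
      intro τ; rw [← residue_sum_chart_zero]; exact htx τ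
    refine MohWindowSurface.exponent_lt_of_chart p h3 c hc (i := 0) (i' := 1) (by decide) (by decide) (by decide) hbd hd2
      a (fun k => min k d) (fun k => min_le_right k d) htx' 𝔴.asIdeal h𝔴 _ h3L ψ hψa (I' := stalkIdeal (E.transform π D).J x') ?_
      hx'sing hxyz₁ hbd₁ a₁ hJ₁
    rw [hstalk, window_sum_chart_zero]
    rfl
  · refine MohWindowSurface.exponent_lt_of_chart p h3 c hc (i := 1) (i' := 0) (by decide) (by decide) (by decide) hbd hd2
      a (fun k => d - k) (fun k => Nat.sub_le d k) hty 𝔴.asIdeal h𝔴 _ h3L ψ hψa (I' := stalkIdeal (E.transform π D).J x') ?_ hx'sing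
      hxyz₁ hbd₁ a₁ hJ₁
    rw [hstalk, window_sum_chart_one]
    rfl
  · -- chart `z`: no singular point (`…ChildCount.lean`)
    exfalso
    have hsing : Submodule.colon (Ideal.span {ψ (c 2 ^ p + ∑ k ∈ Finset.range (d + 1), a k * c 0 ^ (d - k) * c 1 ^ k)})
        ((Ideal.span {ψ (c 2)} ^ p : Ideal _) : Set _) ≤ maximalIdeal (A'.Z.presheaf.stalk x') ^ p := by
      have : c 2 ^ p + ∑ k ∈ Finset.range (d + 1), a k * c 0 ^ (d - k) * c 1 ^ k =
          z ^ p + ∑ k ∈ Finset.range (d + 1), a k * x ^ (d - k) * y ^ k := by rw [hc_def]; rfl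
      rw [this, ← hstalk]; exact hx'sing
    exact MohWindowSurface.not_singular_chart_two h3 c hc (by omega) hbd a 𝔴.asIdeal h𝔴 _ ψ hψa hsing

/-! ## 2. The potential drops at a tame-centred step -/

/-- **The potential `Σ_{Sing} (4p − 1)^{residualOrder}` drops by `≥ 1` at an in-regime step whose centre is TAME** (transport off
the centre, drop over it, child count `≤ 2(2p − 1)`). [folklore] -/
theorem potential_succ_add_one_le_of_tame_centre {D : Closeds A.Z} (π : A'.Z ⟶ A.Z) (hπ : IsBlowup π (vanishingIdeal D))
    (hD : E.IsPermissibleCentre A.hom D) (hRg : Regime.mohWindowSurface A E)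
    (hRg' : Regime.mohWindowSurface A' (E.transform π D))
    (htame : ∀ ξ ∈ (D : Set A.Z), MohWindowSurfaceTameAt E.b (A.Z.presheaf.stalk ξ) (stalkIdeal E.J ξ)) :
    (∑ x' ∈ hRg'.2.1.toFinset, (2 * (2 * p - 1) + 1) ^
        (residualOrder (E.transform π D).b (A'.Z.presheaf.stalk x') (stalkIdeal (E.transform π D).J x')).toNat) + 1 ≤
      ∑ x ∈ hRg.2.1.toFinset, (2 * (2 * p - 1) + 1) ^ (residualOrder E.b (A.Z.presheaf.stalk x) (stalkIdeal E.J x)).toNat :=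
  sum_pow_val_succ_add_one_le π hπ hD hRg.2.1 hRg.2.2.1 hRg'.2.1 _ _
    (fun _ _ hover => congrArg ENat.toNat
      (MohWindowSurfacePermissible.residualOrder_eq_of_not_over_centre (E := E) π hπ hover))
    (fun _ hx' hover => residualOrder_lt_of_over_tame_centre π hπ hD hRg hRg' htame hx' hover) (2 * (2 * p - 1))
    (ncard_sing_inter_preimage_centre_le π hπ hD hRg)

/-! ## 3. The heavy-centre dichotomy -/

/-- **[OURS · L1 W4.6 rung (iii-2), every `p`] AN INFINITE IN-REGIME PERMISSIBLE SEQUENCE BLOWS UP NON-TAME CENTRES INFINITELY OFTEN.**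
For a §2.1-permissible sequence (`PermissibleRun`) all of whose stages lie in `Regime.mohWindowSurface` and every `k₀`, there is a
step `k ≥ k₀` whose centre contains a point at which the window ideal is NOT tame (`¬ MohWindowSurfaceTameAt`: in every coefficient
presentation the residue form has a `κ`-rational root of multiplicity `≥ p` in one of the two charts — a HEAVY point). Otherwise
the potential of `…TameExitBound.lean` would drop by `≥ 1` at every step from `k₀` on. So the open non-tame rung reduces to excluding
infinite sequences with infinitely many heavy centres. NOT a statement of the manuscript. [folklore] -/
theorem PermissibleRun.exists_not_tame_centre_ge (r : PermissibleRun p K)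
    (hr : ∀ k, Regime.mohWindowSurface (r.A k) (r.E k)) (k₀ : ℕ) :
    ∃ k, k₀ ≤ k ∧ ∃ ξ ∈ (r.D k : Set (r.A k).Z),
      ¬ MohWindowSurfaceTameAt (r.E k).b ((r.A k).Z.presheaf.stalk ξ) (stalkIdeal (r.E k).J ξ) := by
  classical
  by_contra hno
  push Not at hno
  let Φ : ℕ → ℕ := fun k => ∑ x ∈ (hr k).2.1.toFinset,
    (2 * (2 * p - 1) + 1) ^ (residualOrder (r.E k).b ((r.A k).Z.presheaf.stalk x) (stalkIdeal (r.E k).J x)).toNat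
  -- the potential step at every `k ≥ k₀`, stated for an arbitrary next stage `E₁ = transform`
  have key : ∀ k (hk : Regime.mohWindowSurface (r.A k) (r.E k)) (E₁ : IdealExponent (r.A (k + 1)).Z)
      (h₁ : Regime.mohWindowSurface (r.A (k + 1)) E₁) (heq : E₁ = (r.E k).transform (r.π k) (r.D k))
      (htame : ∀ ξ ∈ (r.D k : Set (r.A k).Z), MohWindowSurfaceTameAt (r.E k).b ((r.A k).Z.presheaf.stalk ξ) (stalkIdeal (r.E k).J ξ)),
      (∑ x ∈ h₁.2.1.toFinset, (2 * (2 * p - 1) + 1) ^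
          (residualOrder E₁.b ((r.A (k + 1)).Z.presheaf.stalk x) (stalkIdeal E₁.J x)).toNat) + 1 ≤
        ∑ x ∈ hk.2.1.toFinset, (2 * (2 * p - 1) + 1) ^
          (residualOrder (r.E k).b ((r.A k).Z.presheaf.stalk x) (stalkIdeal (r.E k).J x)).toNat := by
    intro k hk E₁ h₁ heq htame
    subst heq
    exact potential_succ_add_one_le_of_tame_centre (r.π k) (r.blowup k) (r.permissible k) hk h₁ htame
  have hstep : ∀ k, k₀ ≤ k → Φ (k + 1) + 1 ≤ Φ k := fun k hk =>
    key k (hr k) (r.E (k + 1)) (hr (k + 1)) (r.E_succ k) (hno k hk)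
  -- telescoping: `Φ (k₀ + j) + j ≤ Φ k₀`
  have htel : ∀ j, Φ (k₀ + j) + j ≤ Φ k₀ := by
    intro j
    induction j with
    | zero => simp
    | succ j ih =>
      have := hstep (k₀ + j) (Nat.le_add_right _ _)
      rw [show k₀ + (j + 1) = k₀ + j + 1 from by ring]
      omega
  have := htel (Φ k₀ + 1)
  omega

end Campaign

end CampaignW46

end Summit.ResolutionOfSingularities.ResolutionOfSingularities.Theorems

end
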